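import Summits.BirchSwinnertonDyer.BirchSwinnertonDyer.Theorems.PrintCf2SplitBadTwoRestrictedSelmerKummerInRestricted
import HarnessLib

/-!
# Crux `PrintCf2.SplitBadTwoRankOneOfFacts` (stmt-BirchSwinnertonDyer-20368), road α, stub S3c — the MIDDLE FACTOR of the bottom value IS a
# subgroup of `Ш(E_K/K)`: `(𝔖_v(K, E[𝔮^∞]) ⊓ L_M) ⧸ Q_M ≅` the image of the summand's true Selmer group in `H¹(K, E)`, inside `Ш(E_K/K)`

Cell `bsd-print-cf2`, width seat `bsd-line-cf2-p1-w7` g2, file 7 of the bottom-value lane (p661732 … `…KummerInRestricted`); `--supports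
stmt-BirchSwinnertonDyer-20368` (helper, Theses-free). HONEST FRAMING: nothing here closes a crux or a stub; BSD is not proved by any of this; no
summit statement is proved by this seat. No definition, no named fact, no `sorry`, no kit. beyond-print theorem: no (plumbing between the tree's
two `H¹` currencies).

WHY. The three-factor bottom value (p663238 / `…KummerInRestricted`) has middle factor `#((𝔖_v(K, M) ⊓ L_M) ⧸ Q_M)` with CANONICAL
`L_M = ι_*⁻¹(localKerOver p ⊤ K_{v̄})`, `Q_M = ι_*⁻¹(res_⊤(range κ))`; the -w8 lineage (B6 chain + B6e, «correction ZERO») counts `Ш(E_K/K)[2^∞]`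
and its eigen-parts in the currency `WeierstrassCurve.sha ≤ H¹(Γ_K, E(K̄))`. This file identifies the middle factor with the order of a
canonical subgroup of `Ш(E_K/K)`: the image of `𝔖_v(K, M) ⊓ L_M` under `H¹(⊤, M) →ι_* H¹(⊤, E[p^∞]) ≃res_⊤⁻¹ H¹(Γ_K, E[p^∞]) → H¹(Γ_K, E(K̄))`.
* §1 (generic topological group `G`, discrete module): `resSubgroup_injective_of_forall_mem`, `resSubgroup_top_surjective` — restriction
  `H¹(G, M) → H¹(⊤, M)` is a bijection (the tree's two `H¹` currencies, `discreteH1 Γ_K` of Selmer.lean/SelmerCorankProofs and `subgroupH1 ⊤`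
  of SubgroupSelmer/Agboola2007, agree); `subgroupH1_eq_zero_of_subsingleton`.
* §2 (elliptic `V/K`): `selmerLocalKerPrimary_eq_comap_localKerOver` — the local condition of `Sel_{p^∞}(E/K)` (Selmer.lean) IS the preimage of
  `localKerOver p ⊤ K_v` (SubgroupSelmer) under `res_⊤` (the tree had `⊆`, `resSubgroup_top_mem_localKerOver`); `localKerOver_top_eq_top_of_isComplex`.
* §3 (the summand `M = E[𝔮^∞]`, any `π`, `r`): for ANY subgroup `S ≤ H¹(⊤, M)` the homomorphism
  `f_S = primaryH1ToH1 ∘ res_⊤⁻¹ ∘ ι_* : S → H¹(K, E)` (built with `AddEquiv.ofBijective res_⊤`) has KERNEL `S ⊓ ι_*⁻¹(res_⊤(ker primaryH1ToH1))`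
  `= S ⊓ Q_M` (`ker_shaMap_eq`, by `range_kummerMapPInfty`) and, when `S` satisfies the classical condition everywhere, RANGE inside `Ш(E_K/K)`
  (`range_shaMap_le_sha`); hence **`natCard_trueSelmer_quotient_eq_natCard_range_shaMap`**: on an imaginary quadratic base with `p = v·v̄`,
  `#((𝔖_v(K, M) ⊓ L_M) ⧸ Q_M) = #f(𝔖_v(K, M) ⊓ L_M)` and `f(𝔖_v(K, M) ⊓ L_M) ≤ Ш(E_K/K)` — the middle factor of the bottom value is the order of
  the image of the summand's true Selmer group in Ш (Agboola's `Ш(K)(𝔭*)`; its identification with the `r`-eigen subgroup `C` of -w8's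
  `card_sha_two_primary_eq_sq` is the remaining eigen bookkeeping).

References: A. Agboola, Compositio 143 (2007) §6 Prop. 6.11 [Agboola2007]; R. Greenberg, LNM 1716 (1999) §2 p. 63 [GreenbergLNM1716];
J.-P. Serre, *Galois Cohomology* I.§2 [SerreGaloisCohomology1997].
-/

noncomputable section

open scoped Classical

set_option linter.dupNamespace false
set_option autoImplicit false

open NumberField IsDedekindDomain Field
open Literature.NumberTheory.EllipticCurves Literature.NumberTheory.EllipticCurves.GreenbergSelmer
open Literature.NumberTheory.EllipticCurves.Castella2018.AcSelmer
open Literature.NumberTheory.EllipticCurves.Agboola2007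
open Literature.NumberTheory.EllipticCurves.ResKernel
open Literature.NumberTheory.GaloisRepresentations

universe u

namespace Summit.BirchSwinnertonDyer.BirchSwinnertonDyer.Theorems.PrintCf2.RestrictedSelmerPair

/-! ## §1. `H¹(G, M) ≅ H¹(⊤, M)`: restriction to the improper subgroup is a bijection -/

section TopBridge

variable {G : Type u} [Group G] [TopologicalSpace G] [IsTopologicalGroup G]
  (N : Subgroup G) (M : Type u) [AddCommGroup M] [DistribMulAction G M] [TopologicalSpace M] [DiscreteTopology M]

/-- **Restriction to a subgroup containing every element is injective on `H¹`** (a cocycle which is a coboundary on `N = G` is a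
coboundary). [cite: SerreGaloisCohomology1997, I.§2.4] -/
theorem resSubgroup_injective_of_forall_mem (hN : ∀ g : G, g ∈ N) : Function.Injective (resSubgroup N M) := by
  rw [injective_iff_map_eq_zero]
  intro x hx
  obtain ⟨φ, rfl⟩ := oneCocycleClass_surjective _ x
  rw [resSubgroup_oneCocycleClass, oneCocycleClass_eq_zero_iff] at hx
  obtain ⟨m, hm⟩ := hx
  rw [oneCocycleClass_eq_zero_iff]
  refine ⟨m, fun g ↦ ?_⟩
  have h := hm ⟨g, hN g⟩
  rw [pullback_subtype_apply] at h
  exact h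

/-- **Restriction `H¹(G, M) → H¹(⊤, M)` is surjective**: a continuous cocycle on `⊤` is the restriction of its transport along the
homeomorphism `G → ⊤`. [cite: SerreGaloisCohomology1997, I.§2.4] -/
theorem resSubgroup_top_surjective : Function.Surjective (resSubgroup (⊤ : Subgroup G) M) := by
  let θ : G →ₜ* (⊤ : Subgroup G) :=
    { toFun := fun g ↦ ⟨g, Subgroup.mem_top g⟩
      map_one' := rfl
      map_mul' := fun _ _ ↦ rfl
      continuous_toFun := continuous_id.subtype_mk _ }
  intro y
  refine ⟨resH1Hom θ (AddMonoidHom.id M) (fun _ _ ↦ rfl) y, ?_⟩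
  have hcomp : (resSubgroup (⊤ : Subgroup G) M).comp (resH1Hom θ (AddMonoidHom.id M) (fun _ _ ↦ rfl)) = AddMonoidHom.id _ := by
    rw [resSubgroup, resH1Hom_comp]
    have hθ : θ.comp (Literature.NumberTheory.EllipticCurves.subgroupIncl (⊤ : Subgroup G)) = ContinuousMonoidHom.id _ :=
      ContinuousMonoidHom.ext fun x ↦ Subtype.ext rfl
    rw [resH1Hom_congr hθ (show (AddMonoidHom.id M).comp (AddMonoidHom.id M) = AddMonoidHom.id M from rfl) _ (fun _ _ ↦ rfl),
      resH1Hom_id]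
  have h := congrArg (fun f ↦ f y) hcomp
  simpa only [AddMonoidHom.comp_apply, AddMonoidHom.id_apply] using h

/-- Restriction `H¹(G, M) → H¹(⊤, M)` is a bijection. [cite: SerreGaloisCohomology1997, I.§2.4] -/
theorem resSubgroup_top_bijective : Function.Bijective (resSubgroup (⊤ : Subgroup G) M) :=
  ⟨resSubgroup_injective_of_forall_mem ⊤ M Subgroup.mem_top, resSubgroup_top_surjective M⟩

variable {G' : Type u} [Group G'] [TopologicalSpace G'] [IsTopologicalGroup G'] [Subsingleton G']
  {N' : Type u} [AddCommGroup N'] [DistribMulAction G' N'] [TopologicalSpace N'] [DiscreteTopology N']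

/-- **`H¹` of a subgroup of a trivial group vanishes** (a crossed homomorphism vanishes at `1`). [cite: SerreGaloisCohomology1997, I.§2.3] -/
theorem subgroupH1_eq_zero_of_subsingleton (H : Subgroup G') (x : subgroupH1 H N') : x = 0 := by
  obtain ⟨φ, rfl⟩ := oneCocycleClass_surjective _ x
  have h1 : ∀ σ : H, σ = 1 := fun σ ↦ Subtype.ext (Subsingleton.elim _ _)
  have hφ : φ = 0 := by
    apply Subtype.ext
    ext σ
    rw [h1 σ]
    exact contOneCocycles.apply_one φ
  rw [hφ]
  exact oneCocycleClass_zero _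

end TopBridge

/-! ## §2. The local condition of `Sel_{p^∞}(E/K)` is the preimage of `localKerOver p ⊤ K_v` under `res_⊤` -/

section LocalBridge

variable {K : Type u} [Field K] [NumberField K] (V : WeierstrassCurve K) (p : ℕ)

omit [NumberField K] in
/-- **`selmerLocalKerPrimary V E p = res_⊤⁻¹ (localKerOver p ⊤ E)`** for every `K`-field `E` (a completion): the square
`H¹(K) → H¹(⊤) → H¹(⊤_E)` / `H¹(K) → H¹(Γ_E) → H¹(⊤_E)` commutes (`resH1Hom_comp_resSubgroup`) and `H¹(Γ_E) → H¹(⊤_E)` is injective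
(`resSubgroup_injective_of_forall_mem`). The tree had `⊆` (`resSubgroup_top_mem_localKerOver`). [cite: GreenbergLNM1716, §2–3] -/
theorem selmerLocalKerPrimary_eq_comap_localKerOver (E : Type u) [Field E] [Algebra K E] :
    V.selmerLocalKerPrimary E p = (V.localKerOver p ⊤ E).comap (resSubgroup ⊤ (V.geomPrimaryTorsion p)) := by
  apply le_antisymm
  · intro c hc
    exact AddSubgroup.mem_comap.mpr (V.resSubgroup_top_mem_localKerOver hc)
  · intro c hc
    have hc' : V.localResOver p ⊤ E (resSubgroup ⊤ (V.geomPrimaryTorsion p) c) = 0 := AddSubgroup.mem_comap.mp hc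
    have hψ : ∀ (σ : absoluteGaloisGroup E) (P : V.geomPrimaryTorsion p),
        ((pointsMap V E).comp (V.geomPrimaryTorsion p).subtype) (resGal (K := K) E σ • P) =
          σ • ((pointsMap V E).comp (V.geomPrimaryTorsion p).subtype) P := fun σ P ↦ by
      simp only [AddMonoidHom.coe_comp, AddSubgroup.coe_subtype, Function.comp_apply,
        Literature.NumberTheory.EllipticCurves.primaryComponent.coe_smul]
      exact pointsMap_smul V E σ P
    have key := ResKernel.resH1Hom_comp_resSubgroup (resGal (K := K) E)
      ((pointsMap V E).comp (V.geomPrimaryTorsion p).subtype) hψ ⊤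
      (localSubgroup (⊤ : Subgroup (absoluteGaloisGroup K)) E)
      (resGalSubgroup (⊤ : Subgroup (absoluteGaloisGroup K)) E) (fun _ ↦ rfl)
      (V.pointsMapOfEmb_comp_subtype_smul p (closureEmb (K := K) E) ⊤)
    have h2 := congrArg (fun f ↦ f c) key
    simp only [AddMonoidHom.comp_apply] at h2
    have h3 : resSubgroup (localSubgroup (⊤ : Subgroup (absoluteGaloisGroup K)) E) (localPoints V E)
        (resH1Hom (resGal (K := K) E) ((pointsMap V E).comp (V.geomPrimaryTorsion p).subtype) hψ c) = 0 := by
      rw [← h2]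
      exact hc'
    have hinj := resSubgroup_injective_of_forall_mem (localSubgroup (⊤ : Subgroup (absoluteGaloisGroup K)) E) (localPoints V E)
      (fun τ ↦ (mem_localSubgroup_iff ⊤ E τ).mpr (Subgroup.mem_top _))
    have h4 : resH1Hom (resGal (K := K) E) ((pointsMap V E).comp (V.geomPrimaryTorsion p).subtype) hψ c = 0 :=
      hinj (by rw [h3, map_zero])
    exact h4

omit [NumberField K] in
/-- **At a complex place the classical local condition is vacuous**: `localKerOver p ⊤ K_w = ⊤` (`Γ_{K_w}` is trivial).
[cite: GreenbergLNM1716, §3 p. 87 (archimedean primes split completely)] -/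
theorem localKerOver_top_eq_top_of_isComplex {w : InfinitePlace K} (hw : w.IsComplex) :
    V.localKerOver p ⊤ w.Completion = ⊤ := by
  haveI : IsAlgClosed w.Completion := by
    let e : ℂ ≃+* w.Completion := (InfinitePlace.Completion.ringEquivComplexOfIsComplex hw).symm
    refine IsAlgClosed.of_exists_root _ fun q hmq hq ↦ ?_
    have hqe : (q.map e.symm.toRingHom).degree ≠ 0 := by
      rw [Polynomial.degree_map]
      exact ne_of_gt (Polynomial.degree_pos_of_irreducible hq)
    obtain ⟨x, hx⟩ := IsAlgClosed.exists_root (k := ℂ) (q.map e.symm.toRingHom) hqe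
    refine ⟨e x, ?_⟩
    rw [Polynomial.IsRoot] at hx
    apply e.symm.injective
    rw [map_zero, ← hx]
    clear hx hqe hq hmq
    induction q using Polynomial.induction_on <;> simp_all
  haveI := subsingleton_absoluteGaloisGroup_of_isAlgClosed w.Completion
  rw [eq_top_iff]
  intro c _
  rw [WeierstrassCurve.mem_localKerOver_iff]
  exact subgroupH1_eq_zero_of_subsingleton _ _

end LocalBridge

/-! ## §3. The middle factor as a subgroup of `Ш(E_K/K)` -/

section ShaBridge

variable {K : Type u} [Field K] [NumberField K] (V : WeierstrassCurve K) [V.IsElliptic] (p : ℕ) [Fact p.Prime]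
  (π : V.endRing) (r : ℤ_[p]) (S : AddSubgroup (subgroupH1 (⊤ : Subgroup (absoluteGaloisGroup K)) ↥(V.endEigenPrimaryTorsion p π r)))

/-- **Kernel of `f_S = (H¹(K, E[p^∞]) → H¹(K, E)) ∘ res_⊤⁻¹ ∘ ι_* : S → H¹(K, E)`**: the classes of `S` whose image in `H¹(⊤, E[p^∞])` is the
restriction of a class dying in `H¹(K, E)` — i.e. `S ⊓ ι_*⁻¹(res_⊤(ker))`, and `ker = range κ` (`range_kummerMapPInfty`): `S ⊓ Q_M`.
[cite: SilvermanAEC2009, §VIII.2] [cite: GreenbergLNM1716, §2 p. 63] -/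
theorem ker_shaMap_eq :
    (((V.primaryH1ToH1 p).comp (AddEquiv.ofBijective (resSubgroup ⊤ (V.geomPrimaryTorsion p))
        (resSubgroup_top_bijective (V.geomPrimaryTorsion p))).symm.toAddMonoidHom).comp
      ((resH1Hom (ContinuousMonoidHom.id _) (V.endEigenPrimaryTorsion p π r).subtype (fun _ _ ↦ rfl)).comp S.subtype)).ker =
      ((((V.kummerMapPInfty p V.zsmul_geomPoints_surjective_holds).range).map (resSubgroup ⊤ (V.geomPrimaryTorsion p))).comap
        (resH1Hom (ContinuousMonoidHom.id _) (V.endEigenPrimaryTorsion p π r).subtype (fun _ _ ↦ rfl))).addSubgroupOf S := by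
  set R := resSubgroup (⊤ : Subgroup (absoluteGaloisGroup K)) (V.geomPrimaryTorsion p) with hR
  set Re := AddEquiv.ofBijective R (resSubgroup_top_bijective (V.geomPrimaryTorsion p)) with hRe
  ext c
  rw [AddMonoidHom.mem_ker, AddSubgroup.mem_addSubgroupOf, AddSubgroup.mem_comap, V.range_kummerMapPInfty p]
  simp only [AddMonoidHom.comp_apply, AddSubgroup.coe_subtype, AddEquiv.coe_toAddMonoidHom]
  constructor
  · intro h
    refine AddSubgroup.mem_map.2 ⟨Re.symm (resH1Hom (ContinuousMonoidHom.id _) (V.endEigenPrimaryTorsion p π r).subtype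
      (fun _ _ ↦ rfl) (c : subgroupH1 ⊤ ↥(V.endEigenPrimaryTorsion p π r))), AddMonoidHom.mem_ker.mpr h, ?_⟩
    change Re (Re.symm _) = _
    exact Re.apply_symm_apply _
  · intro h
    obtain ⟨x, hx, hxc⟩ := AddSubgroup.mem_map.1 h
    have hx' : Re.symm (resH1Hom (ContinuousMonoidHom.id _) (V.endEigenPrimaryTorsion p π r).subtype (fun _ _ ↦ rfl)
        (c : subgroupH1 ⊤ ↥(V.endEigenPrimaryTorsion p π r))) = x := by
      rw [← hxc]
      exact Re.symm_apply_apply x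
    rw [hx']
    exact AddMonoidHom.mem_ker.mp hx

omit [V.IsElliptic] in
/-- **Range of `f_S` lies in `Ш(E_K/K)` when `S` satisfies the classical condition at every place**: if `ι_*(S) ≤ localKerOver p ⊤ K_w` for every
finite and every infinite place `w`, then `res_⊤⁻¹(ι_* c) ∈ Sel_{p^∞}(E/K)` (§2) and its image in `H¹(K, E)` lies in `Ш`
(`selmerGroupPInfty_eq_comap_sha`). [cite: GreenbergLNM1716, §2 p. 63] [cite: SilvermanAEC2009, X.§4] -/
theorem range_shaMap_le_sha
    (hfin : ∀ w : HeightOneSpectrum (𝓞 K), S.map (resH1Hom (ContinuousMonoidHom.id _) (V.endEigenPrimaryTorsion p π r).subtype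
      (fun _ _ ↦ rfl)) ≤ V.localKerOver p ⊤ (w.adicCompletion K))
    (hinf : ∀ w : InfinitePlace K, S.map (resH1Hom (ContinuousMonoidHom.id _) (V.endEigenPrimaryTorsion p π r).subtype
      (fun _ _ ↦ rfl)) ≤ V.localKerOver p ⊤ w.Completion) :
    (((V.primaryH1ToH1 p).comp (AddEquiv.ofBijective (resSubgroup ⊤ (V.geomPrimaryTorsion p))
        (resSubgroup_top_bijective (V.geomPrimaryTorsion p))).symm.toAddMonoidHom).comp
      ((resH1Hom (ContinuousMonoidHom.id _) (V.endEigenPrimaryTorsion p π r).subtype (fun _ _ ↦ rfl)).comp S.subtype)).range ≤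
      V.sha := by
  set R := resSubgroup (⊤ : Subgroup (absoluteGaloisGroup K)) (V.geomPrimaryTorsion p) with hR
  set Re := AddEquiv.ofBijective R (resSubgroup_top_bijective (V.geomPrimaryTorsion p)) with hRe
  rintro _ ⟨c, rfl⟩
  simp only [AddMonoidHom.comp_apply, AddSubgroup.coe_subtype, AddEquiv.coe_toAddMonoidHom]
  set x := Re.symm (resH1Hom (ContinuousMonoidHom.id _) (V.endEigenPrimaryTorsion p π r).subtype (fun _ _ ↦ rfl)
    (c : subgroupH1 ⊤ ↥(V.endEigenPrimaryTorsion p π r))) with hx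
  have hRx : R x = resH1Hom (ContinuousMonoidHom.id _) (V.endEigenPrimaryTorsion p π r).subtype (fun _ _ ↦ rfl)
      (c : subgroupH1 ⊤ ↥(V.endEigenPrimaryTorsion p π r)) := Re.apply_symm_apply _
  have hmem : resH1Hom (ContinuousMonoidHom.id _) (V.endEigenPrimaryTorsion p π r).subtype (fun _ _ ↦ rfl)
      (c : subgroupH1 ⊤ ↥(V.endEigenPrimaryTorsion p π r)) ∈
      S.map (resH1Hom (ContinuousMonoidHom.id _) (V.endEigenPrimaryTorsion p π r).subtype (fun _ _ ↦ rfl)) :=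
    AddSubgroup.mem_map_of_mem _ c.2
  have hsel : x ∈ V.selmerGroupPInfty p := by
    simp only [WeierstrassCurve.selmerGroupPInfty, AddSubgroup.mem_inf, AddSubgroup.mem_iInf]
    refine ⟨fun w ↦ ?_, fun w ↦ ?_⟩
    · rw [selmerLocalKerPrimary_eq_comap_localKerOver, AddSubgroup.mem_comap]
      change R x ∈ _
      rw [hRx]
      exact hfin w hmem
    · rw [selmerLocalKerPrimary_eq_comap_localKerOver, AddSubgroup.mem_comap]
      change R x ∈ _
      rw [hRx]
      exact hinf w hmem
  rw [V.selmerGroupPInfty_eq_comap_sha p, AddSubgroup.mem_comap] at hsel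
  exact hsel

/-- **`#(S ⧸ (S ⊓ Q_M)) = #f_S(S)`** (first isomorphism theorem for `f_S` and `ker_shaMap_eq`).
[cite: Agboola2007, Prop. 6.11 (arXiv p0015:L1–12)] -/
theorem natCard_quotient_eq_natCard_range_shaMap :
    Nat.card (↥S ⧸ ((((V.kummerMapPInfty p V.zsmul_geomPoints_surjective_holds).range).map
        (resSubgroup ⊤ (V.geomPrimaryTorsion p))).comap
          (resH1Hom (ContinuousMonoidHom.id _) (V.endEigenPrimaryTorsion p π r).subtype (fun _ _ ↦ rfl))).addSubgroupOf S) =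
      Nat.card (((V.primaryH1ToH1 p).comp (AddEquiv.ofBijective (resSubgroup ⊤ (V.geomPrimaryTorsion p))
        (resSubgroup_top_bijective (V.geomPrimaryTorsion p))).symm.toAddMonoidHom).comp
      ((resH1Hom (ContinuousMonoidHom.id _) (V.endEigenPrimaryTorsion p π r).subtype (fun _ _ ↦ rfl)).comp S.subtype)).range := by
  rw [← ker_shaMap_eq V p π r S]
  exact Nat.card_congr (QuotientAddGroup.quotientKerEquivRange _).toEquiv

variable (v vbar : HeightOneSpectrum (𝓞 K))

/-- **THE MIDDLE FACTOR OF THE BOTTOM VALUE IS A SUBGROUP OF `Ш(E_K/K)`.** On an imaginary quadratic base with `p = v·v̄` (the S3c frames), for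
`M = E[𝔮^∞]`, `L_M = ι_*⁻¹(localKerOver p ⊤ K_{v̄})`, `Q_M = ι_*⁻¹(res_⊤(range κ))` and the true Selmer group of the summand `𝔖_v(K, M) ⊓ L_M`:
`#((𝔖_v(K, M) ⊓ L_M) ⧸ Q_M) = #f(𝔖_v(K, M) ⊓ L_M)` with `f(𝔖_v(K, M) ⊓ L_M) ≤ Ш(E_K/K)` — Agboola's `Ш(K)(𝔭*)` as the image of the
`𝔭*`-summand's Selmer group; the -w8 B6 chain counts `Ш(E_K/K)[2^∞]`. [cite: Agboola2007, Props. 6.10–6.11 (arXiv p0014:L1–p0015:L12)] -/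
theorem natCard_trueSelmer_quotient_eq_natCard_range_shaMap (hK : IsImaginaryQuadratic K)
    (hall : ∀ w : HeightOneSpectrum (𝓞 K), ((p : ℕ) : 𝓞 K) ∈ w.asIdeal → w = v ∨ w = vbar) :
    Nat.card (↥(restrictedSelmerBase ↥(V.endEigenPrimaryTorsion p π r) p v ⊓
            (V.localKerOver p ⊤ (vbar.adicCompletion K)).comap
              (resH1Hom (ContinuousMonoidHom.id _) (V.endEigenPrimaryTorsion p π r).subtype (fun _ _ ↦ rfl))) ⧸
          ((((V.kummerMapPInfty p V.zsmul_geomPoints_surjective_holds).range).map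
              (resSubgroup ⊤ (V.geomPrimaryTorsion p))).comap
            (resH1Hom (ContinuousMonoidHom.id _) (V.endEigenPrimaryTorsion p π r).subtype (fun _ _ ↦ rfl))).addSubgroupOf
            (restrictedSelmerBase ↥(V.endEigenPrimaryTorsion p π r) p v ⊓
              (V.localKerOver p ⊤ (vbar.adicCompletion K)).comap
                (resH1Hom (ContinuousMonoidHom.id _) (V.endEigenPrimaryTorsion p π r).subtype (fun _ _ ↦ rfl)))) =
      Nat.card (((V.primaryH1ToH1 p).comp (AddEquiv.ofBijective (resSubgroup ⊤ (V.geomPrimaryTorsion p))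
        (resSubgroup_top_bijective (V.geomPrimaryTorsion p))).symm.toAddMonoidHom).comp
      ((resH1Hom (ContinuousMonoidHom.id _) (V.endEigenPrimaryTorsion p π r).subtype (fun _ _ ↦ rfl)).comp
        (restrictedSelmerBase ↥(V.endEigenPrimaryTorsion p π r) p v ⊓
            (V.localKerOver p ⊤ (vbar.adicCompletion K)).comap
              (resH1Hom (ContinuousMonoidHom.id _) (V.endEigenPrimaryTorsion p π r).subtype (fun _ _ ↦ rfl))).subtype)).range ∧
    (((V.primaryH1ToH1 p).comp (AddEquiv.ofBijective (resSubgroup ⊤ (V.geomPrimaryTorsion p))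
        (resSubgroup_top_bijective (V.geomPrimaryTorsion p))).symm.toAddMonoidHom).comp
      ((resH1Hom (ContinuousMonoidHom.id _) (V.endEigenPrimaryTorsion p π r).subtype (fun _ _ ↦ rfl)).comp
        (restrictedSelmerBase ↥(V.endEigenPrimaryTorsion p π r) p v ⊓
            (V.localKerOver p ⊤ (vbar.adicCompletion K)).comap
              (resH1Hom (ContinuousMonoidHom.id _) (V.endEigenPrimaryTorsion p π r).subtype (fun _ _ ↦ rfl))).subtype)).range ≤
      V.sha := by
  refine ⟨natCard_quotient_eq_natCard_range_shaMap V p π r _, range_shaMap_le_sha V p π r _ (fun w ↦ ?_) (fun w ↦ ?_)⟩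
  · rintro _ ⟨c, hc, rfl⟩
    obtain ⟨hcS, hcL⟩ := AddSubgroup.mem_inf.mp hc
    by_cases hw : ((p : ℕ) : 𝓞 K) ∈ w.asIdeal
    · rcases hall w hw with rfl | rfl
      · -- at `v`: strict, hence locally zero, hence classical
        rw [WeierstrassCurve.localKerOver_eq_ofEmb]
        refine Kobayashi2003.localKummerOverOfEmb_le_localKerOverOfEmb ⊥ (AcSigned.awayKer_le_localKummerOverOfEmb V p ⊤ w ⊥ ?_)
        change resOfLe (V.geomPrimaryTorsion p) (inf_le_left : ⊤ ⊓ decomp w ≤ ⊤) _ = 0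
        rw [resOfLe_resH1Hom_subtype V p π r, ((mem_restrictedSelmerBase_iff_resOfLe _ p w c).mp hcS).2.2, map_zero]
      · exact (AddSubgroup.mem_comap).mp hcL
    · rw [localKerOver_top_eq_awayKer V p w hw]
      change resOfLe (V.geomPrimaryTorsion p) (inf_le_left : ⊤ ⊓ decomp w ≤ ⊤) _ = 0
      rw [resOfLe_resH1Hom_subtype V p π r, ((mem_restrictedSelmerBase_iff_resOfLe _ p v c).mp hcS).1 w hw, map_zero]
  · rw [localKerOver_top_eq_top_of_isComplex V p (hK.2.isComplex w)]
    exact le_top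

end ShaBridge

end Summit.BirchSwinnertonDyer.BirchSwinnertonDyer.Theorems.PrintCf2.RestrictedSelmerPair

end
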